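import Literature.AlgebraicGeometry.Resolution.RoofDatum
import Literature.AlgebraicGeometry.Resolution.DChartHensel
import HarnessLib

/-!
# The roof datum — II. The first Hensel chart (the constant `y₀`)

Topic: `Literature/AlgebraicGeometry/Resolution`. M. Temkin, *Inseparable local uniformization*,
J. Algebra 373 (2013) = arXiv:0804.1554v3, Thm. 3.3.1, smooth-fibre case (tree:
`Temkin2013RelativeCurveSmoothFibre`). Continuing `RoofDatum.lean` for a roof datum
`D : RoofDatum k K L₁ Ω`: over the base ring `R = N″ = N[1/s] ⊆ O_V` the polynomial `P₀`
(coefficients in `k° ⊆ N″`), the approximant `ya ∈ N″` and the Newton quotient `β ∈ N″`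
satisfy the hypotheses of the Hensel chart in the field (`HenselChartInField.lean`), whence

* `RoofDatum.T₁`, `.u₁` — **an ÉTALE `N″`-subalgebra `T₁ ⊆ O_V` of `Ω` containing `y₀`**,
  `T₁ = N″[z₀, u₁]` with the zoomed root `z₀ = (y₀ − ya)/P₀′(ya)` and `u₁ = w₀⁻¹`,
  `w₀ = p̃′(z₀)`, `|u₁|_V = 1`; `T₁` is integrally closed — PROVED (the proofs of
  `DChartHensel.lean`, `exists_T₀`, verbatim for the datum).

Everything is [folklore] bookkeeping over the cited files; no named facts.

## Sources

* M. Temkin, arXiv:0804.1554v3, proof of Thm. 3.3.1, Steps 2–4 (pp. 44–45). [Temkin2013]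
-/

noncomputable section

open Polynomial IsLocalRing

namespace Literature.AlgebraicGeometry.Resolution

namespace RoofDatum

universe u

variable {k K L₁ Ω : Type u} [Field k] [Field K] [Field L₁] [Field Ω]
  [Algebra k K] [Algebra K L₁] [Algebra k L₁] [IsScalarTower k K L₁]
  [Algebra L₁ Ω] [Algebra k Ω] [IsScalarTower k L₁ Ω] [FiniteDimensional K L₁]
  (D : RoofDatum k K L₁ Ω)

/-! ### `P₀` over `Ω`, over `L₁`, over `R = N″` -/

/-- `P₀` over `Ω`. [folklore] -/
def P₀Ω : Polynomial Ω := D.P₀.map (algebraMap k Ω)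

/-- `P₀` over `L₁`. [folklore] -/
def P₀L : Polynomial L₁ := D.P₀.map (algebraMap k L₁)

/-- `ya` in `Ω`. [folklore] -/
def yaΩ : Ω := algebraMap L₁ Ω D.ya

/-- `P₀L ↦ P₀Ω`. [folklore] -/
theorem P₀L_map : D.P₀L.map (algebraMap L₁ Ω) = D.P₀Ω := by
  rw [P₀L, P₀Ω, Polynomial.map_map, ← IsScalarTower.algebraMap_eq]

/-- `P₀Ω(y₀) = 0`. [folklore] -/
theorem eval_P₀Ω_y₀ : D.P₀Ω.eval D.y₀ = 0 := by
  rw [P₀Ω, eval_map, ← aeval_def]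
  exact D.hy₀

/-- `P₀Ω′(y₀) ≠ 0`. [folklore] -/
theorem eval_derivative_P₀Ω_y₀_ne_zero : (derivative D.P₀Ω).eval D.y₀ ≠ 0 := by
  rw [P₀Ω, derivative_map, eval_map, ← aeval_def]
  exact D.hy₀'

/-- `aeval ya P₀ = P₀L(ya)`. [folklore] -/
theorem aeval_ya_eq : aeval D.ya D.P₀ = D.P₀L.eval D.ya := by
  rw [P₀L, eval_map, ← aeval_def]

/-- `aeval ya P₀′ = P₀L′(ya)`. [folklore] -/
theorem aeval_ya_derivative_eq : aeval D.ya (derivative D.P₀) = (derivative D.P₀L).eval D.ya := by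
  rw [P₀L, derivative_map, eval_map, ← aeval_def]

/-- The Newton identity over `L₁`: `P₀L(ya) = P₀L′(ya)² β`. [folklore] -/
theorem P₀L_eval_eq : D.P₀L.eval D.ya = (derivative D.P₀L).eval D.ya ^ 2 * D.β := by
  rw [← aeval_ya_eq, ← aeval_ya_derivative_eq]
  exact D.hNewton

/-- `P₀L(ya) ↦ P₀Ω(yaΩ)`. [folklore] -/
theorem algebraMap_P₀L_eval :
    algebraMap L₁ Ω (D.P₀L.eval D.ya) = D.P₀Ω.eval D.yaΩ := by
  rw [← P₀L_map, eval_map, yaΩ, Polynomial.eval₂_hom]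

/-- `P₀L′(ya) ↦ P₀Ω′(yaΩ)`. [folklore] -/
theorem algebraMap_derivative_P₀L_eval :
    algebraMap L₁ Ω ((derivative D.P₀L).eval D.ya) = (derivative D.P₀Ω).eval D.yaΩ := by
  rw [← P₀L_map, derivative_map, eval_map, yaΩ, Polynomial.eval₂_hom]

/-- `P₀Ω′(yaΩ) ≠ 0`. [folklore] -/
theorem eval_derivative_P₀Ω_yaΩ_ne_zero : (derivative D.P₀Ω).eval D.yaΩ ≠ 0 := by
  rw [← algebraMap_derivative_P₀L_eval, ← aeval_ya_derivative_eq]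
  exact (_root_.map_ne_zero _).mpr D.hya'

/-- The Newton closeness in `Ω`-terms. [folklore] -/
theorem valuation_y₀_sub_yaΩ_lt :
    D.V.valuation (D.y₀ - D.yaΩ) < D.V.valuation ((derivative D.P₀Ω).eval D.yaΩ) := by
  rw [← algebraMap_derivative_P₀L_eval, ← aeval_ya_derivative_eq]
  exact D.hclose

/-- `P₀` lifts to `R = N″` (its coefficients lie in `k° ⊆ N″`). [folklore] -/
theorem exists_PR : ∃ PR : Polynomial D.N'', PR.map (algebraMap D.N'' Ω) = D.P₀Ω := by
  have hl : D.P₀Ω ∈ Polynomial.lifts (algebraMap D.N'' Ω) := by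
    refine (Polynomial.lifts_iff_coeff_lifts _).mpr fun n => ?_
    refine ⟨⟨D.P₀Ω.coeff n, ?_⟩, rfl⟩
    rw [P₀Ω, coeff_map]
    exact D.algebraMap_mem_N''_of_mem_Ok (D.hP₀coef n)
  exact (Polynomial.mem_lifts _).mp hl

/-- `P₀` over `R`. [folklore] -/
def PR : Polynomial D.N'' := D.exists_PR.choose

/-- `PR ↦ P₀Ω`. [folklore] -/
theorem PR_map : D.PR.map (algebraMap D.N'' Ω) = D.P₀Ω := D.exists_PR.choose_spec

/-- `ya ∈ R`. [folklore] -/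
def yR : D.N'' := ⟨D.yaΩ, D.yaΩ_mem_N''⟩

/-- `β ∈ R`. [folklore] -/
def βR : D.N'' := ⟨algebraMap L₁ Ω D.β, D.βΩ_mem_N''⟩

/-- `PR(yR) ↦ P₀Ω(yaΩ)`. [folklore] -/
theorem algebraMap_eval_PR : algebraMap D.N'' Ω (D.PR.eval D.yR) = D.P₀Ω.eval D.yaΩ := by
  rw [RelCurveChart.algebraMap_eval_base, D.PR_map]
  rfl

/-- `PR′(yR) ↦ P₀Ω′(yaΩ)`. [folklore] -/
theorem algebraMap_eval_derivative_PR :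
    algebraMap D.N'' Ω ((derivative D.PR).eval D.yR) = (derivative D.P₀Ω).eval D.yaΩ := by
  rw [RelCurveChart.algebraMap_eval_base, ← derivative_map, D.PR_map]
  rfl

/-- **Newton divisibility in `R`**: `PR(yR) = PR′(yR)² βR`. [folklore] -/
theorem PR_eval_eq : D.PR.eval D.yR = (derivative D.PR).eval D.yR ^ 2 * D.βR := by
  apply Subtype.val_injective
  change algebraMap D.N'' Ω (D.PR.eval D.yR) =
    algebraMap D.N'' Ω ((derivative D.PR).eval D.yR ^ 2 * D.βR)
  rw [map_mul, map_pow, algebraMap_eval_PR, algebraMap_eval_derivative_PR, ← D.algebraMap_P₀L_eval,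
    D.P₀L_eval_eq, map_mul, map_pow, D.algebraMap_derivative_P₀L_eval]
  rfl

/-- `PR′(yR) ≠ 0`. [folklore] -/
theorem eval_derivative_PR_ne_zero : (derivative D.PR).eval D.yR ≠ 0 := fun h0 => by
  have h := D.algebraMap_eval_derivative_PR
  rw [h0, map_zero] at h
  exact D.eval_derivative_P₀Ω_yaΩ_ne_zero h.symm

/-- `PR(y₀) = 0`. [folklore] -/
theorem aeval_y₀_PR : aeval D.y₀ D.PR = 0 := by
  rw [aeval_def, ← eval_map, D.PR_map, D.eval_P₀Ω_y₀]

/-- `PR′(y₀) ≠ 0`. [folklore] -/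
theorem aeval_y₀_derivative_PR_ne_zero : aeval D.y₀ (derivative D.PR) ≠ 0 := by
  rw [aeval_def, ← eval_map, ← derivative_map, D.PR_map]
  exact D.eval_derivative_P₀Ω_y₀_ne_zero

/-- The Newton closeness `|y₀ − yR| < |PR′(yR)|` at `V`. [folklore] -/
theorem valuation_y₀_sub_yR_lt :
    D.V.valuation (D.y₀ - algebraMap D.N'' Ω D.yR) <
      D.V.valuation (algebraMap D.N'' Ω ((derivative D.PR).eval D.yR)) := by
  rw [algebraMap_eval_derivative_PR]
  exact D.valuation_y₀_sub_yaΩ_lt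

/-- The zoomed root `z₀ = (y₀ − ya)/P₀′(ya)`. [folklore] -/
def z₀ : Ω := (D.y₀ - D.yaΩ) / (derivative D.P₀Ω).eval D.yaΩ

/-- `z₀` in terms of the `R`-level data. [folklore] -/
theorem z₀_eq :
    D.z₀ = (D.y₀ - algebraMap D.N'' Ω D.yR) / algebraMap D.N'' Ω ((derivative D.PR).eval D.yR) := by
  rw [z₀, algebraMap_eval_derivative_PR]
  rfl

/-- The co-unit `w₀ = p̃′(z₀)` of the first Hensel chart, `p̃ = zoomPoly P₀Ω yaΩ βΩ` — an
explicit polynomial expression in `y₀, ya, β` over `k`. [folklore] -/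
def w₀ : Ω := (derivative (zoomPoly D.P₀Ω D.yaΩ (algebraMap L₁ Ω D.β))).eval D.z₀

/-- `w₀` is the value at `z₀` of the derivative of the `R`-level zoomed polynomial. [folklore] -/
theorem w₀_eq : D.w₀ = aeval
    ((D.y₀ - algebraMap D.N'' Ω D.yR) / algebraMap D.N'' Ω ((derivative D.PR).eval D.yR))
    (derivative (zoomPoly D.PR D.yR D.βR)) := by
  rw [← z₀_eq, aeval_def, ← eval_map, ← derivative_map, RelCurveChart.map_zoomPoly, D.PR_map, w₀]
  rfl

/-! ### The first Hensel chart `T₁` -/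

/-- **The first Hensel chart**: an étale `N″`-subalgebra `T ⊆ O_V` of `Ω` with `y₀ ∈ T`,
generated over `N″` by `z₀` and a unit `u₁` of value `1` with `u₁ w₀ = 1`. [folklore] -/
theorem exists_T₁ : ∃ (T : Subalgebra D.N'' Ω) (u : Ω), Algebra.Etale D.N'' T ∧ D.y₀ ∈ T ∧ u ∈ T ∧
    T = Algebra.adjoin D.N''
      ({(D.y₀ - algebraMap D.N'' Ω D.yR) / algebraMap D.N'' Ω ((derivative D.PR).eval D.yR), u} :
        Set Ω) ∧
    T.toSubring ≤ D.V.toSubring ∧ D.V.valuation u = 1 ∧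
    u * aeval
      ((D.y₀ - algebraMap D.N'' Ω D.yR) / algebraMap D.N'' Ω ((derivative D.PR).eval D.yR))
      (derivative (zoomPoly D.PR D.yR D.βR)) = 1 := by
  haveI : IsIntegrallyClosed D.N'' := D.isIntegrallyClosed_N''
  obtain ⟨T, u, het, hy₀T, huT, hTeq, -, hV, hurel⟩ :=
    exists_henselChart (R := D.N'') (L := Ω) Subtype.val_injective D.PR D.yR D.βR D.PR_eval_eq
      D.eval_derivative_PR_ne_zero D.y₀ D.aeval_y₀_PR D.aeval_y₀_derivative_PR_ne_zero
  obtain ⟨hTV, hvu⟩ := hV D.V D.algebraMap_N''_mem_V D.valuation_y₀_sub_yR_lt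
  exact ⟨T, u, het, hy₀T, huT, hTeq, hTV, hvu, hurel⟩

/-- The first Hensel chart `T₁`. [folklore] -/
def T₁ : Subalgebra D.N'' Ω := D.exists_T₁.choose

/-- Its unit `u₁`. [folklore] -/
def u₁ : Ω := D.exists_T₁.choose_spec.choose

/-- The specification of `(T₁, u₁)`. [folklore] -/
theorem T₁_spec : Algebra.Etale D.N'' D.T₁ ∧ D.y₀ ∈ D.T₁ ∧ D.u₁ ∈ D.T₁ ∧
    D.T₁ = Algebra.adjoin D.N''
      ({(D.y₀ - algebraMap D.N'' Ω D.yR) / algebraMap D.N'' Ω ((derivative D.PR).eval D.yR), D.u₁} :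
        Set Ω) ∧
    D.T₁.toSubring ≤ D.V.toSubring ∧ D.V.valuation D.u₁ = 1 ∧
    D.u₁ * aeval
      ((D.y₀ - algebraMap D.N'' Ω D.yR) / algebraMap D.N'' Ω ((derivative D.PR).eval D.yR))
      (derivative (zoomPoly D.PR D.yR D.βR)) = 1 :=
  D.exists_T₁.choose_spec.choose_spec

/-- `T₁` is étale over `N″`. [folklore] -/
theorem etale_T₁ : Algebra.Etale D.N'' D.T₁ := D.T₁_spec.1

/-- `y₀ ∈ T₁`. [folklore] -/
theorem y₀_mem_T₁ : D.y₀ ∈ D.T₁ := D.T₁_spec.2.1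

/-- `u₁ ∈ T₁`. [folklore] -/
theorem u₁_mem_T₁ : D.u₁ ∈ D.T₁ := D.T₁_spec.2.2.1

/-- `T₁ = N″[z₀, u₁]`. [folklore] -/
theorem T₁_eq_adjoin : D.T₁ = Algebra.adjoin D.N'' ({D.z₀, D.u₁} : Set Ω) := by
  rw [z₀_eq]
  exact D.T₁_spec.2.2.2.1

/-- `T₁ ⊆ O_V`. [folklore] -/
theorem T₁_le_V : D.T₁.toSubring ≤ D.V.toSubring := D.T₁_spec.2.2.2.2.1

/-- `|u₁| = 1`. [folklore] -/
theorem valuation_u₁ : D.V.valuation D.u₁ = 1 := D.T₁_spec.2.2.2.2.2.1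

/-- `u₁ w₀ = 1`. [folklore] -/
theorem u₁_mul_w₀ : D.u₁ * D.w₀ = 1 := by
  rw [w₀_eq]
  exact D.T₁_spec.2.2.2.2.2.2

/-- `u₁ ≠ 0`. [folklore] -/
theorem u₁_ne_zero : D.u₁ ≠ 0 := fun h0 => by
  have h := D.valuation_u₁
  rw [h0, map_zero] at h
  exact zero_ne_one h

/-- `|w₀| = 1`. [folklore] -/
theorem valuation_w₀ : D.V.valuation D.w₀ = 1 := by
  have h := congrArg D.V.valuation D.u₁_mul_w₀
  rw [map_mul, D.valuation_u₁, one_mul, map_one] at h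
  exact h

/-- `z₀ ∈ T₁`. [folklore] -/
theorem z₀_mem_T₁ : D.z₀ ∈ D.T₁ := by
  rw [T₁_eq_adjoin]
  exact Algebra.subset_adjoin (Set.mem_insert _ _)

/-- `N″ ⊆ T₁`. [folklore] -/
theorem mem_T₁_of_mem_N'' {w : Ω} (hw : w ∈ D.N'') : w ∈ D.T₁ := D.T₁.algebraMap_mem ⟨w, hw⟩

/-- `T₁ → Ω` restricted to `N″` is injective (trivially), so `T₁` is integrally closed
(étale over the integrally closed `N″`). [folklore] -/
theorem isIntegrallyClosed_T₁ : IsIntegrallyClosed D.T₁ := by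
  haveI := D.etale_T₁
  haveI : IsIntegrallyClosed D.N'' := D.isIntegrallyClosed_N''
  exact isIntegrallyClosed_of_etale (R := D.N'') (T := D.T₁) fun a b hab => Subtype.ext (by
    have := congrArg (fun w : D.T₁ => (w : Ω)) hab
    exact this)

/-- `T₁` generated: it lies in every subring containing `N″`, `z₀` and `u₁`. [folklore] -/
theorem T₁_le_of_mem {G : Subring Ω} (hN : D.N''.toSubring ≤ G) (hz₀ : D.z₀ ∈ G) (hu₁ : D.u₁ ∈ G) :
    D.T₁.toSubring ≤ G := by
  let G' : Subalgebra D.N'' Ω :=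
    { G with
      algebraMap_mem' := fun r => hN r.2 }
  have h : Algebra.adjoin D.N'' ({D.z₀, D.u₁} : Set Ω) ≤ G' := by
    refine Algebra.adjoin_le ?_
    rintro w (rfl | rfl)
    · exact hz₀
    · exact hu₁
  intro w hw
  rw [T₁_eq_adjoin] at hw
  exact h hw

end RoofDatum

end Literature.AlgebraicGeometry.Resolution

end
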